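import Summits.ValiantsHypothesis.ValiantsHypothesis.Theorems.TwistedDetRankSliceVBPFermionicSymmetricGadget
import Summits.ValiantsHypothesis.ValiantsHypothesis.Theorems.TwistedDetRankSliceVBPFermionicTwoCycleTwist
import Summits.ValiantsHypothesis.ValiantsHypothesis.Theorems.TwistedDetRankSliceVBPFermionicEvenHalf
import Literature.Computability.AlgebraicComplexity.SymmetricOrbitCircuitEval
import Literature.Computability.AlgebraicComplexity.DawarWilsenach2025Thm71
import Summits.ValiantsHypothesis.ValiantsHypothesis.Theorems.ProofCarryingSymmetryAssembly

/-!
# Crux `TwistedDetRank.SliceVBPFermionic` (stmt-ValiantsHypothesis-17991, X2b) — SYMMETRIC TRANSFER: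
# Dawar–Wilsenach's exponential lower bound for every class function with eventually non-zero
# doubling sums; the hypothesis of `stub_symmetricFermionic` / SymA fails on that sub-slice

Third seat on the item (val-width-17991-p1 g2), part 2 of 2 (part 1, the circuit-level return
gadget: Theorems/TwistedDetRankSliceVBPFermionicSymmetricGadget.lean).

* §4  **Dawar–Wilsenach for `χ`** (`symmetric_exp_lower_bound_of_doublingSum_ne_zero`): if the
  `χ_n` are class functions on `S_n` with doubling sums `c_a(χ_{a+a}) ≠ 0` for `a ≥ a₀`, then ANY
  family of square-symmetric circuits computing the GMFs `f_n = Σ_σ χ_n(σ) X^σ` satisfies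
  `2^{ε a} ≤ |C_{a+a}| + 7 (a+a)^2 + 4` for some `ε > 0` and arbitrarily large `a`: the circuits
  `C_{a+a}` transport through the `J`-gadget to square-symmetric circuits for `per_a`
  (`exists_symmetric_perPoly_of_gmf`, part 1), the finitely many small `a` are filled by orbit
  circuits (`exists_symmetric_perPoly`, from `SymmetricOrbitCircuitEval.lean` and the diagonal
  invariance `rename_smul_perPoly`), and the PROVED Theorem 7.1 of Dawar–Wilsenach
  (`DawarWilsenach2025_thm71_holds`, size form `DawarWilsenach2025_thm71.size_form` at `ℂ`) applies
  to the resulting permanent family.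
* §5  Quasi-polynomial form (`not_qpSymmetric_of_doublingSum_ne_zero`; count bookkeeping
  `two_pow_qp_add_absorb`, growth `natLog_add_pow_lt_mul_eventually` of the ProofCarryingSymmetry
  assembly): such a `χ` admits NO
  `S_n`-symmetric circuits of size `≤ 2^((log₂ n + c)^c)` computing its GMFs for every `n`.  That is
  the common HYPOTHESIS of the route's banked residue `Theses.TwistedDetRank.SymA` (stmt-21368) and of
  the registered stub `stub_symmetricFermionic` of X2b, so both hold AT such `χ` — verbatim instances,
  vacuously and unconditionally (`symA_at_of_doublingSum_ne_zero`,
  `symmetricFermionic_at_of_doublingSum_ne_zero`).  Instances: the item's named falsifier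
  `sgn · μ^{c₂}`, `μ ≠ 1` (`twoCycleTwist_not_qpSymmetric`), the even half of the pencil
  (`evenHalfPencil_not_qpSymmetric`), the whole fermionic pencil `Ferm^t = Σ sgn σ t^{c(σ)} X^σ` off
  the natural numbers (`fermionicPencil_not_qpSymmetric`, doubling sums `± ∏_{i<a} (i − t)`,
  `doublingSum_fermionicPencil`), and `χ ≡ 1` (`one_not_qpSymmetric`: Dawar–Wilsenach's theorem
  back in the route's quasi-polynomial currency).

HONEST FRAMING.  Nothing here proves or refutes X2b (X2b ≥ `VNP ⊄ VBP`, Theorems/…Calibration.lean)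
or SymA.  What is new and unconditional is the LOWER BOUND of §4: the exponential square-symmetric
lower bound of Dawar–Wilsenach for the permanent holds for every class-function GMF family whose
doubling sums are eventually non-zero (`sgn · μ^{c₂}` for `μ ≠ 1`, the even halves `t^{c}·[σ even]`,
`sgn · t^{c}` for `t ∉ ℕ`, `cdet`, `HC`, …).  Read with the first seat's
`not_qpTdr_of_doublingSum_ne_zero` (Theorems/…TdrTransfer.lean): on the non-degenerate sub-slice
`{c_a(χ_{a+a}) ≠ 0 eventually}` BOTH the hypothesis and the conclusion of `stub_symmetricFermionic`
fail, so all content of the director's line `stub_restorationVBP → stub_symmetricFermionic` — like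
all content of X2b beyond Valiant's conjecture — lives on the degenerate sub-slice
`{c_a(χ_{a+a}) = 0 infinitely often}` (D^even, G_n, Ferm_k for k ∈ ℕ, near-sgn characters, …), where
SymA is the "arithmetic CFI for mixtures of deep characters" of the route text.  `VP ≠ VNP` is not
moved by this item alone.

References: A. Dawar, G. Wilsenach, *Symmetric Arithmetic Circuits*, Theory of Computing 21 (2025),
Thm. 7.1 (proved in the tree: `DawarWilsenach2025Thm71.lean`); A. Dawar, B. Pago, T. Seppelt,
*Symmetric Algebraic Circuits and Homomorphism Polynomials*, arXiv:2502.06740 (ITCS 2026), Thm. 3.5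
(irreducible characters; not used here).
-/

-- single-conjunct layout: Sub = Summit, duplicated namespace component intended
set_option linter.dupNamespace false

noncomputable section

namespace Summit.ValiantsHypothesis.ValiantsHypothesis.Theorems.TwistedDetRankSliceVBPFermionic

open Equiv MvPolynomial Filter Literature.Computability.AlgebraicComplexity
open Summit.ValiantsHypothesis.ValiantsHypothesis.Theorems.TwistedDetRankFermionicNormalForm
open scoped BigOperators

/-! ## §4 Dawar–Wilsenach for every class function with eventually non-zero doubling sums -/

section LowerBound

/-- `per_n` is invariant under the diagonal action of `S_n` on the variable matrix
(`per(P X Pᵀ) = per X`). [folklore] -/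
theorem rename_smul_perPoly (n : ℕ) (σ : Perm (Fin n)) :
    rename (fun pq : Fin n × Fin n => σ • pq) (perPoly (Fin n) ℂ) = perPoly (Fin n) ℂ := by
  rw [perPoly_eq_sum_prod]
  simp only [map_sum, map_prod, rename_X, Prod.smul_mk, Equiv.Perm.smul_def]
  -- reindex `q ↦ σ q σ⁻¹` and `i ↦ σ i`
  refine Fintype.sum_equiv (MulAut.conj σ).toEquiv _ _ fun q => ?_
  refine (Fintype.prod_equiv σ _ _ fun i => ?_)
  simp [MulAut.conj_apply, Equiv.Perm.mul_apply]

/-- Every `per_n` has SOME square-symmetric circuit (the orbit circuit of the tree; size irrelevant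
here — it only fills the finitely many small `n` of a family). [folklore] -/
theorem exists_symmetric_perPoly (n : ℕ) :
    ∃ (G : Type) (_ : Fintype G) (C : LabelledArithCircuit ℂ (Fin n × Fin n) Unit G),
      C.IsSymmetric (Perm (Fin n)) ∧ C.eval (C.output ()) = perPoly (Fin n) ℂ := by
  obtain ⟨G, hG, C, hs, he, -⟩ :=
    OrbitCircuit.exists_symmetric_circuit_of_invariant (perPoly (Fin n) ℂ) (rename_smul_perPoly n)
  exact ⟨G, hG, C, hs, he⟩

/-- **Dawar–Wilsenach's exponential lower bound, transported to every class function with eventually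
non-zero doubling sums.** Let `χ_n` be class functions on `S_n` with `c_a(χ_{a+a}) ≠ 0` for `a ≥ a₀`,
and let `(C_n)` be ANY family of square-symmetric circuits computing the GMFs `f_n = Σ_σ χ_n(σ) X^σ`.
Then for some `ε > 0` and arbitrarily large `a`: `2^{ε a} ≤ |C_{a+a}| + 7 (a+a)^2 + 4`.
Proof: the circuits `C_{a+a}` transport through the `J`-gadget to square-symmetric circuits for
`per_a` (`exists_symmetric_perPoly_of_gmf`), the small `a` are filled by orbit circuits, and the PROVED
Theorem 7.1 of Dawar–Wilsenach (`DawarWilsenach2025_thm71_holds`, size form at `ℂ`) applies to the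
resulting permanent family. [cite: DawarWilsenach2025, Thm. 7.1] -/
theorem symmetric_exp_lower_bound_of_doublingSum_ne_zero (χ : (n : ℕ) → Perm (Fin n) → ℂ)
    (hχ : ∀ (n : ℕ) (σ τ : Perm (Fin n)), χ n (τ * σ * τ⁻¹) = χ n σ)
    {a₀ : ℕ} (hd : ∀ a, a₀ ≤ a → doublingSum (χ (a + a)) ≠ 0)
    (G : ℕ → Type) [∀ n, Fintype (G n)]
    (C : ∀ n, LabelledArithCircuit ℂ (Fin n × Fin n) Unit (G n))
    (hs : ∀ n, (C n).IsSymmetric (Perm (Fin n)))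
    (he : ∀ n, (C n).eval ((C n).output ()) = ∑ σ : Perm (Fin n), MvPolynomial.C (χ n σ) *
        ∏ i, (X (σ i, i) : MvPolynomial (Fin n × Fin n) ℂ)) :
    ∃ ε : ℝ, 0 < ε ∧ ∀ n₀ : ℕ, ∃ a ≥ n₀,
      (2 : ℝ) ^ (ε * a) ≤ (Fintype.card (G (a + a)) + (7 * (a + a) ^ 2 + 4) : ℕ) := by
  -- a square-symmetric permanent family, small where the doubling sums are non-zero
  have key : ∀ a : ℕ, ∃ (G' : Type) (_ : Fintype G') (C' : LabelledArithCircuit ℂ (Fin a × Fin a) Unit G'),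
      C'.IsSymmetric (Perm (Fin a)) ∧ C'.eval (C'.output ()) = perPoly (Fin a) ℂ ∧
      (a₀ ≤ a → Fintype.card G' ≤ Fintype.card (G (a + a)) + (7 * (a + a) ^ 2 + 4)) := by
    intro a
    by_cases ha : a₀ ≤ a
    · obtain ⟨G', hG', C', h1, h2, h3⟩ :=
        exists_symmetric_perPoly_of_gmf (χ (a + a)) (hχ (a + a)) (hd a ha) (hs (a + a)) (he (a + a))
      exact ⟨G', hG', C', h1, h2, fun _ => h3⟩
    · obtain ⟨G', hG', C', h1, h2⟩ := exists_symmetric_perPoly a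
      exact ⟨G', hG', C', h1, h2, fun h => absurd h ha⟩
  choose G' hG' C' hsym hper hcard using key
  obtain ⟨ε, hε, hio⟩ :=
    @DawarWilsenach2025_thm71.size_form DawarWilsenach2025_thm71_holds ℂ _ _ G' hG' C' hsym hper
  refine ⟨ε, hε, fun n₀ => ?_⟩
  obtain ⟨a, ha, hle⟩ := hio (max n₀ a₀)
  refine ⟨a, le_of_max_le_left ha, hle.trans ?_⟩
  exact_mod_cast hcard a (le_of_max_le_right ha)

end LowerBound

/-! ## §5 Quasi-polynomial form: the hypothesis of SymA / `stub_symmetricFermionic` fails on the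
non-degenerate sub-slice -/

section QuasiPolynomial


/-- Count bookkeeping: `2^((log₂(a+a)+c)^c) + 7 (a+a)^2 + 4 ≤ 2^((log₂ a + (c+6))^(c+6))`. [folklore] -/
theorem two_pow_qp_add_absorb (c a : ℕ) :
    2 ^ ((Nat.log 2 (a + a) + c) ^ c) + (7 * (a + a) ^ 2 + 4) ≤
      2 ^ ((Nat.log 2 a + (c + 6)) ^ (c + 6)) := by
  set ℓ := Nat.log 2 a with hℓ
  have h1 : Nat.log 2 (a + a) ≤ ℓ + 1 := by
    rcases Nat.eq_zero_or_pos a with rfl | ha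
    · simp
    · rw [← two_mul, mul_comm, Nat.log_mul_base one_lt_two ha.ne']
  have h2 : a < 2 ^ (ℓ + 1) := Nat.lt_pow_succ_log_self one_lt_two a
  have h3 : 7 * (a + a) ^ 2 + 4 ≤ 2 ^ (2 * ℓ + 7) := by
    have haa : a + a < 2 ^ (ℓ + 2) := by rw [pow_succ]; omega
    have hsq : (a + a) ^ 2 < 2 ^ (ℓ + 2) * 2 ^ (ℓ + 2) := by
      rw [sq]; exact Nat.mul_lt_mul'' haa haa
    have h22 : 2 ^ (2 * ℓ + 7) = 2 ^ (ℓ + 2) * 2 ^ (ℓ + 2) * 8 := by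
      rw [← pow_add, show 2 * ℓ + 7 = (ℓ + 2 + (ℓ + 2)) + 3 by ring, pow_add]
      norm_num
    have h4 : 4 ≤ 2 ^ (ℓ + 2) * 2 ^ (ℓ + 2) := by
      have h44 : 4 ≤ 2 ^ (ℓ + 2) :=
        calc 4 = 2 ^ 2 := by norm_num
          _ ≤ 2 ^ (ℓ + 2) := Nat.pow_le_pow_right two_pos (by omega)
      nlinarith
    omega
  have h4 : (Nat.log 2 (a + a) + c) ^ c ≤ (ℓ + c + 6) ^ c :=
    Nat.pow_le_pow_left (by omega) c
  have h5 : ∀ A B : ℕ, 2 ^ A + 2 ^ B ≤ 2 ^ (A + B + 1) := by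
    intro A B
    rw [pow_succ, mul_two]
    exact Nat.add_le_add (Nat.pow_le_pow_right two_pos (Nat.le_add_right A B))
      (Nat.pow_le_pow_right two_pos (Nat.le_add_left B A))
  have h6 : (ℓ + c + 6) ^ c + (2 * ℓ + 7) + 1 ≤ (ℓ + (c + 6)) ^ (c + 6) := by
    have hm : (ℓ + (c + 6)) ^ (c + 6) = (ℓ + c + 6) ^ c * (ℓ + c + 6) ^ 6 := by
      rw [show ℓ + (c + 6) = ℓ + c + 6 by ring, ← pow_add]
    rw [hm]
    have hA'1 : 1 ≤ (ℓ + c + 6) ^ c := Nat.one_le_pow _ _ (by omega)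
    have hm6 : 2 * ℓ + 9 ≤ (ℓ + c + 6) ^ 6 :=
      calc 2 * ℓ + 9 ≤ (ℓ + c + 6) * (ℓ + c + 6) := by nlinarith
        _ = (ℓ + c + 6) ^ 2 := (sq _).symm
        _ ≤ (ℓ + c + 6) ^ 6 := Nat.pow_le_pow_right (by omega) (by norm_num)
    nlinarith [hA'1, hm6]
  calc 2 ^ ((Nat.log 2 (a + a) + c) ^ c) + (7 * (a + a) ^ 2 + 4)
      ≤ 2 ^ ((ℓ + c + 6) ^ c) + 2 ^ (2 * ℓ + 7) :=
        Nat.add_le_add (Nat.pow_le_pow_right two_pos h4) h3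
    _ ≤ 2 ^ ((ℓ + c + 6) ^ c + (2 * ℓ + 7) + 1) := h5 _ _
    _ ≤ 2 ^ ((ℓ + (c + 6)) ^ (c + 6)) := Nat.pow_le_pow_right two_pos h6

/-- **No quasi-polynomial square-symmetric circuits on the non-degenerate sub-slice.** A class
function `χ` whose doubling sums `c_a(χ_{a+a})` are eventually non-zero does NOT admit
`S_n`-symmetric circuits of size `≤ 2^((log₂ n + c)^c)` computing its GMFs for every `n` — the
common HYPOTHESIS of SymA (`Theses.TwistedDetRank.SymA`, stmt-21368) and of the registered stub
`stub_symmetricFermionic` of X2b fails for it.  (Exponential bound of §4, absorbed: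
`two_pow_qp_add_absorb`, against `(log₂ a + c')^c' < ε a` eventually,
`natLog_add_pow_lt_mul_eventually` of Theorems/ProofCarryingSymmetryAssembly.lean.) [cite: DawarWilsenach2025, Thm. 7.1] -/
theorem not_qpSymmetric_of_doublingSum_ne_zero (χ : (n : ℕ) → Perm (Fin n) → ℂ)
    (hχ : ∀ (n : ℕ) (σ τ : Perm (Fin n)), χ n (τ * σ * τ⁻¹) = χ n σ)
    {a₀ : ℕ} (hd : ∀ a, a₀ ≤ a → doublingSum (χ (a + a)) ≠ 0) :
    ¬ ∃ c : ℕ, ∀ n : ℕ, ∃ (G : Type) (_ : Fintype G)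
        (C : LabelledArithCircuit ℂ (Fin n × Fin n) Unit G),
        C.IsSymmetric (Equiv.Perm (Fin n)) ∧
        C.eval (C.output ()) = (∑ σ : Equiv.Perm (Fin n), MvPolynomial.C (χ n σ) *
          ∏ i : Fin n, (MvPolynomial.X (σ i, i) : MvPolynomial (Fin n × Fin n) ℂ)) ∧
        Fintype.card G ≤ 2 ^ ((Nat.log 2 n + c) ^ c) := by
  rintro ⟨c, hc⟩
  choose G hG C hsym heval hcard using hc
  obtain ⟨ε, hε, hio⟩ :=
    @symmetric_exp_lower_bound_of_doublingSum_ne_zero χ hχ a₀ hd G hG C hsym heval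
  obtain ⟨n₀, hn₀⟩ :=
    Summit.ValiantsHypothesis.Theorems.ProofCarryingSymmetry.natLog_add_pow_lt_mul_eventually
      (c + 6) hε
  obtain ⟨a, ha, hle⟩ := hio n₀
  have h1 : ((Fintype.card (G (a + a)) + (7 * (a + a) ^ 2 + 4) : ℕ) : ℝ) ≤
      (2 : ℝ) ^ (((Nat.log 2 a + (c + 6)) ^ (c + 6) : ℕ) : ℝ) := by
    rw [Real.rpow_natCast]
    exact_mod_cast (Nat.add_le_add_right (hcard (a + a)) _).trans (two_pow_qp_add_absorb c a)
  have h2 : ε * a ≤ (((Nat.log 2 a + (c + 6)) ^ (c + 6) : ℕ) : ℝ) :=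
    (Real.rpow_le_rpow_left_iff one_lt_two).1 (hle.trans h1)
  exact absurd (hn₀ a ha) (not_lt.2 h2)

/-- **SymA holds on the non-degenerate sub-slice** (vacuously, and unconditionally): for a class
function with eventually non-zero doubling sums the instance of `Theses.TwistedDetRank.SymA`
(stmt-ValiantsHypothesis-21368) at `χ` is true because its hypothesis is refuted
(`not_qpSymmetric_of_doublingSum_ne_zero`).  The content of SymA lives on `{c_a(χ_{a+a}) = 0 i.o.}`.
[cite: DawarWilsenach2025, Thm. 7.1] -/
theorem symA_at_of_doublingSum_ne_zero (χ : (n : ℕ) → Perm (Fin n) → ℂ)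
    (hχ : ∀ (n : ℕ) (σ τ : Perm (Fin n)), χ n (τ * σ * τ⁻¹) = χ n σ)
    {a₀ : ℕ} (hd : ∀ a, a₀ ≤ a → doublingSum (χ (a + a)) ≠ 0) :
    (∃ c : ℕ, ∀ n : ℕ, ∃ (G : Type) (_ : Fintype G)
        (C : LabelledArithCircuit ℂ (Fin n × Fin n) Unit G),
        C.IsSymmetric (Equiv.Perm (Fin n)) ∧
        C.eval (C.output ()) = (∑ σ : Equiv.Perm (Fin n), MvPolynomial.C (χ n σ) *
          ∏ i : Fin n, (MvPolynomial.X (σ i, i) : MvPolynomial (Fin n × Fin n) ℂ)) ∧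
        Fintype.card G ≤ 2 ^ ((Nat.log 2 n + c) ^ c)) →
    ∃ c : ℕ, ∀ n : ℕ, 1 ≤ n → ∃ r ≤ 2 ^ ((Nat.log 2 n + c) ^ c),
      ∃ (a : Fin r → ℂ) (g : Fin r → Equiv.Perm (Fin n) → ℂ),
        (∀ t, (∃ (F : ℕ → ℂ) (m : Multiset ℕ), (∀ j ∈ m, 2 ≤ j) ∧ m.sum ≤ (Nat.log 2 n + c) ^ c ∧
            g t = fun σ => ((Equiv.Perm.sign σ : ℤ) : ℂ) *
              F (Finset.univ.filter fun i => σ i = i).card *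
                (m.map fun j => ((σ.cycleType.count j : ℕ) : ℂ)).prod) ∨
          (∃ G : Multiset ℕ → ℂ, g t = fun σ =>
            if σ.support.card ≤ (Nat.log 2 n + c) ^ c then G σ.cycleType else 0)) ∧
        χ n = ∑ t, a t • g t :=
  fun h => absurd h (not_qpSymmetric_of_doublingSum_ne_zero χ hχ hd)

/-- **The registered stub `stub_symmetricFermionic` of X2b holds on the non-degenerate sub-slice**
(its statement at `χ`, verbatim; vacuously and unconditionally): a class function with eventually
non-zero doubling sums has no quasi-polynomial symmetric circuits, so "qp symmetric circuits ⇒ qp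
twisted-determinant sums" is true for it.  Read with the landed `not_qpTdr_of_doublingSum_ne_zero`
(Theorems/…TdrTransfer.lean): on this sub-slice BOTH the hypothesis and the conclusion of the stub
fail; all content of the director's line `stub_restorationVBP → stub_symmetricFermionic` beyond
Valiant's conjecture lives on `{c_a(χ_{a+a}) = 0 infinitely often}`.
[cite: DawarWilsenach2025, Thm. 7.1] -/
theorem symmetricFermionic_at_of_doublingSum_ne_zero (χ : (n : ℕ) → Perm (Fin n) → ℂ)
    (hχ : ∀ (n : ℕ) (σ τ : Perm (Fin n)), χ n (τ * σ * τ⁻¹) = χ n σ)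
    {a₀ : ℕ} (hd : ∀ a, a₀ ≤ a → doublingSum (χ (a + a)) ≠ 0) :
    (∃ c : ℕ, ∀ n : ℕ, ∃ (G : Type) (_ : Fintype G)
        (C : LabelledArithCircuit ℂ (Fin n × Fin n) Unit G),
        C.IsSymmetric (Equiv.Perm (Fin n)) ∧
        C.eval (C.output ()) = (∑ σ : Equiv.Perm (Fin n), MvPolynomial.C (χ n σ) *
          ∏ i : Fin n, (MvPolynomial.X (σ i, i) : MvPolynomial (Fin n × Fin n) ℂ)) ∧
        Fintype.card G ≤ 2 ^ ((Nat.log 2 n + c) ^ c)) →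
    ∃ c : ℕ, ∀ n : ℕ, 1 ≤ n → ∃ r ≤ 2 ^ ((Nat.log 2 n + c) ^ c),
      ∃ E : Fin r → Matrix (Fin n) (Fin n) ℂ,
        (∑ σ : Equiv.Perm (Fin n), MvPolynomial.C (χ n σ) *
          ∏ i : Fin n, (MvPolynomial.X (σ i, i) : MvPolynomial (Fin n × Fin n) ℂ)) =
        ∑ t, (Matrix.of fun i j => MvPolynomial.C (E t i j) * MvPolynomial.X (i, j)).det :=
  fun h => absurd h (not_qpSymmetric_of_doublingSum_ne_zero χ hχ hd)

/-! ### Instances: the named falsifier and the even half of the pencil -/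

/-- **The item's named falsifier `sgn · μ^{c₂}` (`μ ≠ 1`) has no quasi-polynomial square-symmetric
circuits** — unconditionally (its doubling sums are `± det((μ−1)·1 + J_a) ≠ 0` for large `a`,
`doublingSum_twoCycleTwist_ne_zero`).  With `twoCycleTwist_not_qpTdr` (tdr side) and
`not_dcPerSuperpolynomial_of_twoCycleTwist_hasDetRepr` (dc side) this family is now placed on all
three axes of the line. [cite: DawarWilsenach2025, Thm. 7.1] -/
theorem twoCycleTwist_not_qpSymmetric {μ : ℂ} (hμ : μ ≠ 1) :
    ¬ ∃ c : ℕ, ∀ n : ℕ, ∃ (G : Type) (_ : Fintype G)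
        (C : LabelledArithCircuit ℂ (Fin n × Fin n) Unit G),
        C.IsSymmetric (Equiv.Perm (Fin n)) ∧
        C.eval (C.output ()) = (∑ σ : Equiv.Perm (Fin n), MvPolynomial.C (twoCycleTwist μ n σ) *
          ∏ i : Fin n, (MvPolynomial.X (σ i, i) : MvPolynomial (Fin n × Fin n) ℂ)) ∧
        Fintype.card G ≤ 2 ^ ((Nat.log 2 n + c) ^ c) := by
  obtain ⟨a₀, ha₀⟩ := doublingSum_twoCycleTwist_ne_zero hμ
  exact not_qpSymmetric_of_doublingSum_ne_zero (twoCycleTwist μ) (twoCycleTwist_conj μ) ha₀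

/-- **The even half of the pencil `t^{c}·[σ even]` (`t ≥ 1`) has no quasi-polynomial square-symmetric
circuits** — unconditionally (doubling sums positive for `a ≥ 2`, `doublingSum_evenHalfPencil_ne_zero`).
[cite: DawarWilsenach2025, Thm. 7.1] -/
theorem evenHalfPencil_not_qpSymmetric {t : ℕ} (ht : 1 ≤ t) :
    ¬ ∃ c : ℕ, ∀ n : ℕ, ∃ (G : Type) (_ : Fintype G)
        (C : LabelledArithCircuit ℂ (Fin n × Fin n) Unit G),
        C.IsSymmetric (Equiv.Perm (Fin n)) ∧
        C.eval (C.output ()) = (∑ σ : Equiv.Perm (Fin n), MvPolynomial.C (evenHalfPencil t n σ) *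
          ∏ i : Fin n, (MvPolynomial.X (σ i, i) : MvPolynomial (Fin n × Fin n) ℂ)) ∧
        Fintype.card G ≤ 2 ^ ((Nat.log 2 n + c) ^ c) :=
  not_qpSymmetric_of_doublingSum_ne_zero (evenHalfPencil t) (evenHalfPencil_conj t) (a₀ := 2)
    fun _ ha => doublingSum_evenHalfPencil_ne_zero ht ha

/-- The doubling sums of the FERMIONIC PENCIL `sgn · t^{c}` (`c` = number of cycles counting fixed
points): `c_a = ε · (−1)^a · ∏_{i<a} (i − t)` — the block-swap sign `ε`, the cycle formula for the
sign (`sign_mul_neg_one_pow_numCycles`) and the cycle generating polynomial of `S_a`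
(`∑_ρ β^{c(ρ)} = ∏_{i<a} (β + i)`, `cycW_allOnes_fin`, at `β = −t`). [folklore] -/
theorem doublingSum_fermionicPencil (t : ℂ) (a : ℕ) :
    doublingSum (fun σ : Perm (Fin (a + a)) => ((Perm.sign σ : ℤ) : ℂ) * t ^ σ.numCycles) =
      ((Perm.sign (Equiv.sumComm (Fin a) (Fin a) : Perm (Fin a ⊕ Fin a)) : ℤ) : ℂ) *
        ((-1) ^ a * ∏ i ∈ Finset.range a, (-t + i)) := by
  unfold doublingSum
  have hcyc := FermionicJetHcProjectsToCdet.cycW_allOnes_fin (R := ℂ) (-t) a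
  unfold DeRugyAltherre.cycW at hcyc
  simp only [Finset.prod_const_one, mul_one] at hcyc
  rw [← hcyc, Finset.mul_sum, Finset.mul_sum]
  refine Finset.sum_congr rfl fun ρ _ => ?_
  dsimp only
  rw [Perm.sign_permCongr, sign_swapPerm, Perm.sign_one, mul_one,
    DeRugyAltherre.numCycles_permCongr, numCycles_swapPerm_one, Units.val_mul, Int.cast_mul]
  have hsgn : ((Perm.sign ρ : ℤ) : ℂ) = (-1) ^ a * (-1) ^ ρ.numCycles := by
    have h := Perm.sign_mul_neg_one_pow_numCycles ρ
    rw [Fintype.card_fin] at h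
    have h2 : (Perm.sign ρ : ℤ) = (-1) ^ a * (-1) ^ ρ.numCycles := by
      calc (Perm.sign ρ : ℤ) = (Perm.sign ρ : ℤ) * (-1) ^ ρ.numCycles * (-1) ^ ρ.numCycles := by
            rw [mul_assoc, ← pow_add, ← two_mul, pow_mul, neg_one_sq, one_pow, mul_one]
        _ = (-1) ^ a * (-1) ^ ρ.numCycles := by rw [h]
    exact_mod_cast congrArg (Int.cast : ℤ → ℂ) h2
  rw [hsgn, neg_pow t]
  ring

/-- **The fermionic pencil `Ferm^t = Σ_σ sgn σ · t^{c(σ)} X^σ` off the natural numbers (`t ∉ ℕ`,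
e.g. `t = 1/2` or `t = −1`… any non-natural complex `t`) has no quasi-polynomial square-symmetric
circuits** — unconditionally: its doubling sums `± ∏_{i<a} (i − t)` never vanish.  (For `t = k ∈ ℕ`,
the fermionants `Ferm_k`, the doubling sums vanish from `a = k + 1` on: the degenerate sub-slice,
not covered.)  Complements `not_dcPerSuperpolynomial_of_fermionicPencil_hasDetRepr` (dc side, rational
`t ∉ {0,1}`, via de Rugy-Altherre). [cite: DawarWilsenach2025, Thm. 7.1] -/
theorem fermionicPencil_not_qpSymmetric (t : ℂ) (ht : ∀ k : ℕ, t ≠ k) :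
    ¬ ∃ c : ℕ, ∀ n : ℕ, ∃ (G : Type) (_ : Fintype G)
        (C : LabelledArithCircuit ℂ (Fin n × Fin n) Unit G),
        C.IsSymmetric (Equiv.Perm (Fin n)) ∧
        C.eval (C.output ()) = fermionicPencil (Fin n) ℂ t ∧
        Fintype.card G ≤ 2 ^ ((Nat.log 2 n + c) ^ c) := by
  have h := not_qpSymmetric_of_doublingSum_ne_zero
    (fun n (σ : Perm (Fin n)) => ((Perm.sign σ : ℤ) : ℂ) * t ^ σ.numCycles) (fun n σ τ => by
      rw [conj_eq_permCongr, Perm.sign_permCongr, DeRugyAltherre.numCycles_permCongr]) (a₀ := 0)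
    (fun a _ => by
      rw [doublingSum_fermionicPencil]
      refine mul_ne_zero (Int.cast_ne_zero.2 (Units.ne_zero _)) (mul_ne_zero (pow_ne_zero _ ?_) ?_)
      · norm_num
      · rw [Finset.prod_ne_zero_iff]
        intro i _ hi
        exact ht i (by linear_combination -hi))
  simpa only [fermionicPencil_eq_gmf] using h

/-- **`per_n` itself** (`χ ≡ 1`, doubling sums `a! ≠ 0`): the transport returns Dawar–Wilsenach's
theorem in the quasi-polynomial form used by the route (sanity check of the calibration
`dcPerSuperpolynomial_of_restorationVBP`, now without the detour through `dc`). [cite: DawarWilsenach2025, Thm. 7.1] -/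
theorem one_not_qpSymmetric :
    ¬ ∃ c : ℕ, ∀ n : ℕ, ∃ (G : Type) (_ : Fintype G)
        (C : LabelledArithCircuit ℂ (Fin n × Fin n) Unit G),
        C.IsSymmetric (Equiv.Perm (Fin n)) ∧
        C.eval (C.output ()) = (∑ σ : Equiv.Perm (Fin n), MvPolynomial.C (1 : ℂ) *
          ∏ i : Fin n, (MvPolynomial.X (σ i, i) : MvPolynomial (Fin n × Fin n) ℂ)) ∧
        Fintype.card G ≤ 2 ^ ((Nat.log 2 n + c) ^ c) := by
  refine not_qpSymmetric_of_doublingSum_ne_zero (fun _ _ => (1 : ℂ)) (fun _ _ _ => rfl)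
    (a₀ := 0) fun a _ => ?_
  unfold doublingSum
  rw [Finset.sum_const, nsmul_eq_mul, mul_one, Finset.card_univ]
  exact_mod_cast (Fintype.card_ne_zero (α := Perm (Fin a)))

end QuasiPolynomial

end Summit.ValiantsHypothesis.ValiantsHypothesis.Theorems.TwistedDetRankSliceVBPFermionic

end
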